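import Literature.Barriers.CriticalPhenomena.GridSAWUniformDrawingCount
import HarnessLib

/-!
# Barrier `GridSAWCountingSharpPComplete`, tower step (T1): uniformising a grid drawing by towers,
# and `#HamPath = SAWCOUNT₁(E₂, τ, h)` as numbers

Sibling of `GridSAWCountingSharpPComplete.lean` (the barrier: Liśkiewicz–Ogihara–Toda 2003,
Theorem 7 (1) ∧ (4)), `GridSAWCountingViaGridHamPath.lean` (the pivot `GRIDHAMPATHCOUNT`, grid
drawings `IsGridDrawing`, the named sub-fact `LOT2003_thm7_fixedLength_towers :
GRIDHAMPATHCOUNT ≤ᵖ_{parsimonious} SAWCOUNT₁`) and `GridSAWUniformDrawingCount.lean` ((T2): for a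
UNIFORM congestion-free drawing — all edges realised by paths of the same length — the SAWs of
length `ℓ (N - 1)` between two vertex images are equinumerous with the Hamiltonian paths). This
file PROVES (T1), the geometric half of the tower step: every congestion-free grid drawing of a
graph of maximum degree three can be re-drawn, congestion-free and with the same abstract graph,
so that ALL edges are realised by grid paths of one common length — the content of the source's
`E₀ ↦ E₁ ↦ E₂`:

> "We enlarge `E₁` by a factor of `L`. … We replace for each `i`, `1 ≤ i ≤ I(e)`, the edge
> `a(2i)` by the tower of width 1 and of height `L` going from `a(2i)` … Each tower increases the
> length of the path by `2L`. So, for all edges `e` of `G′`, `e` is realized by a path of length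
> `L²`." [LOT2003, §4, proof of Theorem 7, PDF p. 11]

and concludes, with (T2), the counting identity behind `R₁(x) = (E₂, τ, h)`:
`hamPathCount_eq_sawCountFixedLength_uniformize`. What then remains of
`LOT2003_thm7_fixedLength_towers` is (T3): the instance map is polynomial-time (an `FP` string
function; not here).

## The construction (a variant of the printed one, same mechanism)

The source first bends every path to contain a horizontal run (`E₁`, factor `4`), then scales by
`L` and inserts towers of height `L` on a horizontal run. Here, to keep the geometry uniform, the
towers stand on the FIRST unit edge of each path, whatever its direction, leaving it on its left
(`rot`), and interference is excluded by residues modulo the scaling factor: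

* `Λ = maxEdges D` (the largest number of unit edges of a drawn path, `≥ 1`), factor
  `M = bigM Λ = 24 Λ`; every unit edge `(a, a + u)` becomes the run `runPt M a u i = M a + i u`,
  `0 ≤ i ≤ M` (`scalePath`);
* the path with `λ` unit edges receives `T = towerCount = 2 (Λ - λ)` towers of height `6 Λ` on
  its first run, at the offsets `8Λ + 2j` (`towerOffsets`; columns in `[8Λ, 12Λ)`): the tower at
  offset `o` replaces the unit edge between the run points `o`, `o + 1` by the detour up the
  column `o`, across, down the column `o + 1` (`tower`, `towerPt M a u c k = M a + c u + k rot u`);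
  each tower adds `12 Λ`, so the new path has `M λ + 24 Λ (Λ - λ) = 24 Λ²` unit edges
  (`length_newPath`, `length_uniformize`);
* **residues**: a run point has a coordinate divisible by `M`; a tower point has both
  coordinates `≢ 0 (mod M)`, its first residue in one of four disjoint windows according to the
  direction (`towerPt_residues`); hence tower points avoid all runs and scaled vertex images
  (`towerPt_ne_runPt`, `towerPt_ne_smul`) and determine direction, base, column and height
  (`towerPt_inj`); two runs share an inner point only if they traverse the same unit edge
  (`runPt_eq_runPt`, from `M (a' - a) = t u - t' u'` coordinatewise); a self-avoiding path
  traverses no unit edge twice (`runPt_path_eq`), and two drawn edges sharing a unit edge, or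
  their first unit edge, would pass through two common vertex images and have the same ends
  (`sameEnds_of_two_common`), which a drawing excludes.

## Main results (namespace `Literature.Barriers.CriticalPhenomena.GridSAW`)

* `newPath`, `nodup_newPath`, `isChain_newPath`, `head?_newPath`, `getLast?_newPath`,
  `mem_newPath` (points = scaled path ∪ towers), `length_newPath` (`= 24 Λ² + 1` points);
* `uniformize P D = (P₂, D₂)` (`P₂ = M • P`, same end pairs `map_ends_uniformize`), and
  **`isGridDrawing_uniformize`**: it is again a congestion-free grid drawing of maximum degree
  three (`isDrawnEdgeOf_newPath`, `newPath_common`, `drawnDegree_uniformize`), uniform by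
  `length_uniformize`;
* **`hamPathCount_eq_sawCountFixedLength_uniformize`**: for `N ≥ 2` vertices and `s, t < N`,
  `hamPathCount N D s t = sawCountFixedLength (E₂ - P₂[s]) (P₂[t] - P₂[s]) (24 Λ² (N - 1))`
  with `E₂ = drawnEdges D₂` (a subgraph of the grid, `isGridSubgraph_uniformize`).

The one-vertex graph (`N = 1`) is excluded as in (T2) (its Hamiltonian path `[0]` has no
counterpart walk); (T3) must special-case it.

## References

* M. Liśkiewicz, M. Ogihara, S. Toda, *The complexity of counting self-avoiding walks in
  subgraphs of two-dimensional grids and hypercubes*, TCS 304 (2003) 129–156, §4, proof of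
  Theorem 7 (`E₁`, `E₂`, towers, `h = L²(N+1)`; Fig. 7).
-/

namespace Literature.Barriers.CriticalPhenomena.GridSAW

/-! ### Cells and residues -/

/-- **Cell/residue uniqueness**: `M a + r = M a' + r'` with residues in `[0, M)` forces `a = a'`
and `r = r'`. [folklore] -/
theorem cell_residue_unique {M a a' r r' : ℤ} (hM : 0 < M) (h : M * a + r = M * a' + r')
    (hr : 0 ≤ r) (hrM : r < M) (hr' : 0 ≤ r') (hr'M : r' < M) : a = a' ∧ r = r' := by
  have ha : a = a' := by
    have h1 : (r + M * a) / M = a := by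
      rw [Int.add_mul_ediv_left _ _ hM.ne', Int.ediv_eq_zero_of_lt hr hrM, zero_add]
    have h2 : (r' + M * a') / M = a' := by
      rw [Int.add_mul_ediv_left _ _ hM.ne', Int.ediv_eq_zero_of_lt hr' hr'M, zero_add]
    rw [← h1, ← h2, add_comm r, add_comm r', h]
  subst ha
  exact ⟨rfl, by linarith⟩

/-! ### Unit vectors and the quarter turn -/

/-- The four unit vectors of `ℤ²`. [folklore] -/
def IsUnitVec (u : GridPoint) : Prop := u = (1, 0) ∨ u = (-1, 0) ∨ u = (0, 1) ∨ u = (0, -1)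

/-- Decidability of `IsUnitVec`. [folklore] -/
instance (u : GridPoint) : Decidable (IsUnitVec u) := by unfold IsUnitVec; infer_instance

/-- A grid edge is a unit step: `IsGridEdge p q ↔ IsUnitVec (q - p)`. [folklore] -/
theorem isGridEdge_iff_isUnitVec (p q : GridPoint) : IsGridEdge p q ↔ IsUnitVec (q - p) := by
  obtain ⟨a, b⟩ := p; obtain ⟨c, d⟩ := q
  simp only [IsGridEdge, IsUnitVec, Prod.mk_sub_mk, Prod.mk.injEq]
  omega

/-- The quarter turn `(x, y) ↦ (-y, x)` (the direction in which a tower leaves its run).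
[folklore] -/
def rot (u : GridPoint) : GridPoint := (-u.2, u.1)

/-- A unit vector has a coordinate description. [folklore] -/
theorem IsUnitVec.cases {u : GridPoint} (h : IsUnitVec u) :
    (u.1 = 1 ∧ u.2 = 0) ∨ (u.1 = -1 ∧ u.2 = 0) ∨ (u.1 = 0 ∧ u.2 = 1) ∨ (u.1 = 0 ∧ u.2 = -1) := by
  rcases h with rfl | rfl | rfl | rfl <;> simp


/-! ### Points of scaled runs and of towers -/

/-- The `i`-th point of the run realising the unit edge `(a, a + u)` after enlarging by `M`:
`M a + i u`. [cite: LiskiewiczOgiharaToda2003, §4 (proof of Theorem 7: "We enlarge … by a factor")] -/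
def runPt (M : ℕ) (a u : GridPoint) (i : ℕ) : GridPoint := (M : ℤ) • a + (i : ℤ) • u

/-- The point at height `k` of column `c` of a tower standing on the run of `(a, a + u)`:
`M a + c u + k rot(u)`. [cite: LiskiewiczOgiharaToda2003, §4 (proof of Theorem 7: "the tower of width 1 and of height L")] -/
def towerPt (M : ℕ) (a u : GridPoint) (c k : ℕ) : GridPoint :=
  (M : ℤ) • a + (c : ℤ) • u + (k : ℤ) • rot u

/-- Coordinates of a run point. [folklore] -/
theorem runPt_fst (M : ℕ) (a u : GridPoint) (i : ℕ) : (runPt M a u i).1 = M * a.1 + i * u.1 := by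
  simp [runPt]
/-- Coordinates of a run point. [folklore] -/
theorem runPt_snd (M : ℕ) (a u : GridPoint) (i : ℕ) : (runPt M a u i).2 = M * a.2 + i * u.2 := by
  simp [runPt]
/-- Coordinates of a tower point. [folklore] -/
theorem towerPt_fst (M : ℕ) (a u : GridPoint) (c k : ℕ) :
    (towerPt M a u c k).1 = M * a.1 + c * u.1 - k * u.2 := by
  simp [towerPt, rot]; ring
/-- Coordinates of a tower point. [folklore] -/
theorem towerPt_snd (M : ℕ) (a u : GridPoint) (c k : ℕ) :
    (towerPt M a u c k).2 = M * a.2 + c * u.2 + k * u.1 := by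
  simp [towerPt, rot]

/-- Consecutive run points are grid-adjacent. [folklore] -/
theorem isGridEdge_runPt_succ (M : ℕ) (a : GridPoint) {u : GridPoint} (hu : IsUnitVec u) (i : ℕ) :
    IsGridEdge (runPt M a u i) (runPt M a u (i + 1)) := by
  rw [isGridEdge_iff_isUnitVec]
  convert hu using 1
  simp [runPt, add_smul]

/-- The foot of a tower column is adjacent to its first point. [folklore] -/
theorem isGridEdge_runPt_towerPt (M : ℕ) (a : GridPoint) {u : GridPoint} (hu : IsUnitVec u) (c : ℕ) :
    IsGridEdge (runPt M a u c) (towerPt M a u c 1) := by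
  rw [isGridEdge_iff_isUnitVec]
  have : towerPt M a u c 1 - runPt M a u c = rot u := by simp [towerPt, runPt]
  rw [this]
  rcases hu with rfl | rfl | rfl | rfl <;> decide

/-- Consecutive points of a tower column are adjacent. [folklore] -/
theorem isGridEdge_towerPt_succ (M : ℕ) (a : GridPoint) {u : GridPoint} (hu : IsUnitVec u) (c k : ℕ) :
    IsGridEdge (towerPt M a u c k) (towerPt M a u c (k + 1)) := by
  rw [isGridEdge_iff_isUnitVec]
  have : towerPt M a u c (k + 1) - towerPt M a u c k = rot u := by
    simp [towerPt, add_smul]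
  rw [this]
  rcases hu with rfl | rfl | rfl | rfl <;> decide

/-- The tops of the two columns of a tower are adjacent. [folklore] -/
theorem isGridEdge_towerPt_top (M : ℕ) (a : GridPoint) {u : GridPoint} (hu : IsUnitVec u) (c k : ℕ) :
    IsGridEdge (towerPt M a u c k) (towerPt M a u (c + 1) k) := by
  rw [isGridEdge_iff_isUnitVec]
  have : towerPt M a u (c + 1) k - towerPt M a u c k = u := by
    simp [towerPt, add_smul]
  rw [this]; exact hu

/-- `IsGridEdge` is symmetric. [folklore] -/
theorem IsGridEdge.symm {p q : GridPoint} (h : IsGridEdge p q) : IsGridEdge q p := by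
  unfold IsGridEdge at *; omega

/-! ### Residues: run points have a coordinate divisible by `M`, tower points have none -/

section Residues

variable {Λ : ℕ}

/-- The enlargement factor `M = 24 Λ`. [folklore] -/
def bigM (Λ : ℕ) : ℕ := 24 * Λ

/-- **The coordinates of a tower point modulo `M`**: for columns `c ∈ [8Λ, 12Λ)` and heights
`k ∈ [1, 6Λ]`, each coordinate is `M q + r` with a residue `0 < r < M`; the first residue lies
in one of four pairwise disjoint windows according to the direction `u`. Stated as the existence
of such decompositions with the window bounds. [folklore] -/
theorem towerPt_residues {u : GridPoint} (hu : IsUnitVec u) (a : GridPoint) {c k : ℕ}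
    (hc : 8 * Λ ≤ c) (hc' : c < 12 * Λ) (hk : 1 ≤ k) (hk' : k ≤ 6 * Λ) :
    ∃ qx qy rx ry : ℤ, (towerPt (bigM Λ) a u c k).1 = bigM Λ * qx + rx ∧
      (towerPt (bigM Λ) a u c k).2 = bigM Λ * qy + ry ∧ 0 < rx ∧ rx < bigM Λ ∧ 0 < ry ∧ ry < bigM Λ ∧
      ((u = (1, 0) ∧ rx = c ∧ ry = k) ∨ (u = (-1, 0) ∧ rx = bigM Λ - c ∧ ry = bigM Λ - k) ∨
        (u = (0, 1) ∧ rx = bigM Λ - k ∧ ry = c) ∨ (u = (0, -1) ∧ rx = k ∧ ry = bigM Λ - c)) := by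
  rw [towerPt_fst, towerPt_snd]
  unfold bigM
  push_cast
  rcases hu with rfl | rfl | rfl | rfl
  · exact ⟨a.1, a.2, c, k, by ring, by ring, by omega, by omega, by omega, by omega, Or.inl ⟨rfl, rfl, rfl⟩⟩
  · refine ⟨a.1 - 1, a.2 - 1, 24 * Λ - c, 24 * Λ - k, by push_cast; ring, by push_cast; ring,
      by omega, by omega, by omega, by omega, Or.inr (Or.inl ⟨rfl, rfl, rfl⟩)⟩
  · refine ⟨a.1 - 1, a.2, 24 * Λ - k, c, by push_cast; ring, by push_cast; ring,
      by omega, by omega, by omega, by omega, Or.inr (Or.inr (Or.inl ⟨rfl, rfl, rfl⟩))⟩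
  · refine ⟨a.1, a.2 - 1, k, 24 * Λ - c, by push_cast; ring, by push_cast; ring,
      by omega, by omega, by omega, by omega, Or.inr (Or.inr (Or.inr ⟨rfl, rfl, rfl⟩))⟩

/-- **A run point has a coordinate divisible by `M`.** [folklore] -/
theorem runPt_coord_mul (M : ℕ) {u : GridPoint} (hu : IsUnitVec u) (a : GridPoint) (i : ℕ) :
    (runPt M a u i).2 = M * a.2 ∨ (runPt M a u i).1 = M * a.1 := by
  rw [runPt_fst, runPt_snd]
  rcases hu.cases with ⟨-, h⟩ | ⟨-, h⟩ | ⟨h, -⟩ | ⟨h, -⟩ <;> simp [h]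

/-- **Tower points are not run points** (of any run): a run point has a coordinate `≡ 0`
modulo `M`, a tower point has none. [cite: LiskiewiczOgiharaToda2003, §4 (proof of Theorem 7: towers do "not interfere with the other paths")] -/
theorem towerPt_ne_runPt {u : GridPoint} (hu : IsUnitVec u) (a : GridPoint) {c k : ℕ}
    (hc : 8 * Λ ≤ c) (hc' : c < 12 * Λ) (hk : 1 ≤ k) (hk' : k ≤ 6 * Λ)
    {u' : GridPoint} (hu' : IsUnitVec u') (a' : GridPoint) (i : ℕ) :
    towerPt (bigM Λ) a u c k ≠ runPt (bigM Λ) a' u' i := by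
  intro h
  have hM : (0 : ℤ) < bigM Λ := by unfold bigM; push_cast; omega
  obtain ⟨qx, qy, rx, ry, hx, hy, hrx, hrxM, hry, hryM, -⟩ := towerPt_residues hu a hc hc' hk hk'
  rcases runPt_coord_mul (bigM Λ) hu' a' i with h2 | h1
  · have := (cell_residue_unique hM (by rw [← hy, h, h2, add_zero]) hry.le hryM le_rfl hM).2
    omega
  · have := (cell_residue_unique hM (by rw [← hx, h, h1, add_zero]) hrx.le hrxM le_rfl hM).2
    omega

/-- **Tower points are not scaled lattice points** `M p`. [folklore] -/
theorem towerPt_ne_smul {u : GridPoint} (hu : IsUnitVec u) (a : GridPoint) {c k : ℕ}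
    (hc : 8 * Λ ≤ c) (hc' : c < 12 * Λ) (hk : 1 ≤ k) (hk' : k ≤ 6 * Λ) (p : GridPoint) :
    towerPt (bigM Λ) a u c k ≠ (bigM Λ : ℤ) • p := by
  have h := towerPt_ne_runPt hu a hc hc' hk hk' hu p 0
  simpa [runPt] using h

/-- **Tower points determine their data**: equal tower points (columns and heights in the
windows) have the same direction, base, column and height. [folklore] -/
theorem towerPt_inj {u u' : GridPoint} (hu : IsUnitVec u) (hu' : IsUnitVec u') (a a' : GridPoint)
    {c k c' k' : ℕ} (hc : 8 * Λ ≤ c) (hc₁ : c < 12 * Λ) (hk : 1 ≤ k) (hk₁ : k ≤ 6 * Λ)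
    (hc' : 8 * Λ ≤ c') (hc'₁ : c' < 12 * Λ) (hk' : 1 ≤ k') (hk'₁ : k' ≤ 6 * Λ)
    (h : towerPt (bigM Λ) a u c k = towerPt (bigM Λ) a' u' c' k') :
    u = u' ∧ a = a' ∧ c = c' ∧ k = k' := by
  have hM : (0 : ℤ) < bigM Λ := by unfold bigM; push_cast; omega
  obtain ⟨qx, qy, rx, ry, hx, hy, hrx, hrxM, hry, hryM, hcase⟩ := towerPt_residues hu a hc hc₁ hk hk₁
  obtain ⟨qx', qy', rx', ry', hx', hy', hrx', hrxM', hry', hryM', hcase'⟩ :=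
    towerPt_residues hu' a' hc' hc'₁ hk' hk'₁
  obtain ⟨hq1, hr1⟩ := cell_residue_unique hM (by rw [← hx, ← hx', h]) hrx.le hrxM hrx'.le hrxM'
  obtain ⟨hq2, hr2⟩ := cell_residue_unique hM (by rw [← hy, ← hy', h]) hry.le hryM hry'.le hryM'
  unfold bigM at *
  push_cast at *
  have key : u = u' ∧ c = c' ∧ k = k' := by
    rcases hcase with ⟨rfl, rfl, rfl⟩ | ⟨rfl, rfl, rfl⟩ | ⟨rfl, rfl, rfl⟩ | ⟨rfl, rfl, rfl⟩ <;>
    rcases hcase' with ⟨rfl, rfl, rfl⟩ | ⟨rfl, rfl, rfl⟩ | ⟨rfl, rfl, rfl⟩ | ⟨rfl, rfl, rfl⟩ <;>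
    first
    | exact ⟨rfl, by omega, by omega⟩
    | (exfalso; omega)
  obtain ⟨rfl, rfl, rfl⟩ := key
  refine ⟨rfl, ?_, rfl, rfl⟩
  have h1 := congrArg Prod.fst h
  have h2 := congrArg Prod.snd h
  rw [towerPt_fst, towerPt_fst] at h1
  rw [towerPt_snd, towerPt_snd] at h2
  push_cast at h1 h2
  have hM' : (0 : ℤ) < 24 * Λ := hM
  ext
  · nlinarith
  · nlinarith

/-- `runPt M a u 0 = M a`. [folklore] -/
@[simp] theorem runPt_zero (M : ℕ) (a u : GridPoint) : runPt M a u 0 = (M : ℤ) • a := by simp [runPt]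

/-- `runPt M a u M = M (a + u)`. [folklore] -/
theorem runPt_self (M : ℕ) (a u : GridPoint) : runPt M a u M = (M : ℤ) • (a + u) := by simp [runPt]

/-- A multiple of `M` of absolute value below `M` vanishes. [folklore] -/
theorem int_mul_eq_small {M d x : ℤ} (hM : 0 < M) (h : M * d = x) (hx : -M < x) (hx' : x < M) :
    d = 0 ∧ x = 0 := by
  have hd : d = 0 := by
    rcases lt_trichotomy d 0 with hd | hd | hd
    · nlinarith
    · exact hd
    · nlinarith
  subst hd; simp at h; exact ⟨rfl, h.symm⟩

/-- A multiple of `M` of absolute value below `2M` is `0` or `±M`. [folklore] -/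
theorem int_mul_eq_small₂ {M d x : ℤ} (hM : 0 < M) (h : M * d = x) (hx : -(2 * M) < x) (hx' : x < 2 * M) :
    d = -1 ∨ d = 0 ∨ d = 1 := by
  rcases lt_trichotomy d 0 with hd | hd | hd
  · left; nlinarith
  · exact Or.inr (Or.inl hd)
  · right; right; nlinarith

/-- The vector equation behind two coinciding run points: `M (a' - a) = t u - t' u'`,
coordinatewise. [folklore] -/
theorem runPt_eq_runPt_coords {M : ℕ} {a a' u u' : GridPoint} {t t' : ℕ}
    (h : runPt M a u t = runPt M a' u' t') :
    (M : ℤ) * (a'.1 - a.1) = t * u.1 - t' * u'.1 ∧ (M : ℤ) * (a'.2 - a.2) = t * u.2 - t' * u'.2 := by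
  have hx := congrArg Prod.fst h
  have hy := congrArg Prod.snd h
  rw [runPt_fst, runPt_fst] at hx
  rw [runPt_snd, runPt_snd] at hy
  constructor <;> linarith

/-- **A scaled lattice point on a run is its base point**: `M p = runPt M a u t` with `t < M`
forces `t = 0` and `p = a`. [folklore] -/
theorem smul_eq_runPt {M : ℕ} {u : GridPoint} (hu : IsUnitVec u) {a p : GridPoint} {t : ℕ} (htM : t < M)
    (h : (M : ℤ) • p = runPt M a u t) : t = 0 ∧ p = a := by
  have hM : (0 : ℤ) < M := by omega
  rw [← runPt_zero M p u] at h
  obtain ⟨hx, hy⟩ := runPt_eq_runPt_coords h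
  simp only [Nat.cast_zero, zero_mul, zero_sub] at hx hy
  obtain ⟨p1, p2⟩ := p
  obtain ⟨a1, a2⟩ := a
  rcases hu.cases with ⟨h1, h2⟩ | ⟨h1, h2⟩ | ⟨h1, h2⟩ | ⟨h1, h2⟩ <;>
    simp only [h1, h2, mul_one, mul_zero, mul_neg, neg_neg, neg_zero] at hx hy <;>
    simp only [Prod.mk.injEq]
  all_goals
    obtain ⟨h3, h4⟩ := int_mul_eq_small hM hx (by omega) (by omega)
    obtain ⟨h5, h6⟩ := int_mul_eq_small hM hy (by omega) (by omega)
    exact ⟨by omega, by omega, by omega⟩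

/-- **When two run points coincide** (parameters `t, t' < M`): either both are the scaled base
points (`t = t' = 0`, `a = a'`), or they are the same point of the same run, or the two runs
traverse the same unit edge in opposite directions (`a' = a + u`, `u' = -u`, `t + t' = M`).
[folklore] -/
theorem runPt_eq_runPt {M : ℕ} {u u' : GridPoint} (hu : IsUnitVec u) (hu' : IsUnitVec u')
    {a a' : GridPoint} {t t' : ℕ} (htM : t < M) (ht'M : t' < M)
    (h : runPt M a u t = runPt M a' u' t') :
    (t = 0 ∧ t' = 0 ∧ a = a') ∨ (0 < t ∧ t = t' ∧ a = a' ∧ u = u') ∨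
      (0 < t ∧ 0 < t' ∧ a' = a + u ∧ u' = -u ∧ t + t' = M) := by
  have hM : (0 : ℤ) < M := by omega
  rcases Nat.eq_zero_or_pos t with rfl | ht
  · rw [runPt_zero] at h
    obtain ⟨rfl, rfl⟩ := smul_eq_runPt hu' ht'M h
    exact Or.inl ⟨rfl, rfl, rfl⟩
  rcases Nat.eq_zero_or_pos t' with rfl | ht'
  · rw [runPt_zero] at h
    obtain ⟨rfl, -⟩ := smul_eq_runPt hu htM h.symm
    omega
  right
  obtain ⟨hx, hy⟩ := runPt_eq_runPt_coords h
  obtain ⟨a1, a2⟩ := a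
  obtain ⟨b1, b2⟩ := a'
  rcases hu with rfl | rfl | rfl | rfl <;> rcases hu' with rfl | rfl | rfl | rfl <;>
    simp only [mul_one, mul_zero, mul_neg, sub_zero, zero_sub, sub_neg_eq_add] at hx hy <;>
    simp only [Prod.mk.injEq, Prod.mk_add_mk, Prod.neg_mk, neg_neg, neg_zero, add_zero]
  -- 16 cases: same direction / opposite direction / different axes
  · obtain ⟨h3, h4⟩ := int_mul_eq_small hM hx (by omega) (by omega)
    obtain ⟨h5, h6⟩ := int_mul_eq_small hM hy (by omega) (by omega)
    left; exact ⟨ht, by omega, ⟨by omega, by omega⟩, trivial⟩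
  · rcases int_mul_eq_small₂ hM hx (by omega) (by omega) with hd | hd | hd
    · rw [hd] at hx; omega
    · rw [hd] at hx; omega
    · obtain ⟨h5, h6⟩ := int_mul_eq_small hM hy (by omega) (by omega)
      rw [hd] at hx
      right; exact ⟨ht, ht', ⟨by omega, by omega⟩, trivial, by omega⟩
  · exfalso; obtain ⟨h3, h4⟩ := int_mul_eq_small hM hx (by omega) (by omega); omega
  · exfalso; obtain ⟨h3, h4⟩ := int_mul_eq_small hM hx (by omega) (by omega); omega
  · rcases int_mul_eq_small₂ hM hx (by omega) (by omega) with hd | hd | hd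
    · obtain ⟨h5, h6⟩ := int_mul_eq_small hM hy (by omega) (by omega)
      rw [hd] at hx
      right; exact ⟨ht, ht', ⟨by omega, by omega⟩, trivial, by omega⟩
    · rw [hd] at hx; omega
    · rw [hd] at hx; omega
  · obtain ⟨h3, h4⟩ := int_mul_eq_small hM hx (by omega) (by omega)
    obtain ⟨h5, h6⟩ := int_mul_eq_small hM hy (by omega) (by omega)
    left; exact ⟨ht, by omega, ⟨by omega, by omega⟩, trivial⟩
  · exfalso; obtain ⟨h3, h4⟩ := int_mul_eq_small hM hx (by omega) (by omega); omega
  · exfalso; obtain ⟨h3, h4⟩ := int_mul_eq_small hM hx (by omega) (by omega); omega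
  · exfalso; obtain ⟨h3, h4⟩ := int_mul_eq_small hM hy (by omega) (by omega); omega
  · exfalso; obtain ⟨h3, h4⟩ := int_mul_eq_small hM hy (by omega) (by omega); omega
  · obtain ⟨h3, h4⟩ := int_mul_eq_small hM hy (by omega) (by omega)
    obtain ⟨h5, h6⟩ := int_mul_eq_small hM hx (by omega) (by omega)
    left; exact ⟨ht, by omega, ⟨by omega, by omega⟩, trivial⟩
  · rcases int_mul_eq_small₂ hM hy (by omega) (by omega) with hd | hd | hd
    · rw [hd] at hy; omega
    · rw [hd] at hy; omega
    · obtain ⟨h5, h6⟩ := int_mul_eq_small hM hx (by omega) (by omega)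
      rw [hd] at hy
      right; exact ⟨ht, ht', ⟨by omega, by omega⟩, trivial, by omega⟩
  · exfalso; obtain ⟨h3, h4⟩ := int_mul_eq_small hM hy (by omega) (by omega); omega
  · exfalso; obtain ⟨h3, h4⟩ := int_mul_eq_small hM hy (by omega) (by omega); omega
  · rcases int_mul_eq_small₂ hM hy (by omega) (by omega) with hd | hd | hd
    · obtain ⟨h5, h6⟩ := int_mul_eq_small hM hx (by omega) (by omega)
      rw [hd] at hy
      right; exact ⟨ht, ht', ⟨by omega, by omega⟩, trivial, by omega⟩
    · rw [hd] at hy; omega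
    · rw [hd] at hy; omega
  · obtain ⟨h3, h4⟩ := int_mul_eq_small hM hy (by omega) (by omega)
    obtain ⟨h5, h6⟩ := int_mul_eq_small hM hx (by omega) (by omega)
    left; exact ⟨ht, by omega, ⟨by omega, by omega⟩, trivial⟩

end Residues

/-! ### Towers, runs with towers, scaled paths -/

/-- **The tower** inserted between the run points `o` and `o + 1`: up the column `o` to height
`h`, across, and down the column `o + 1` ("the tower of width 1 and of height L going from
a(2i)"). [cite: LiskiewiczOgiharaToda2003, §4 (proof of Theorem 7, E₂ and Fig. 7)] -/
def tower (M : ℕ) (a u : GridPoint) (o h : ℕ) : List GridPoint :=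
  ((List.range h).map fun k => towerPt M a u o (k + 1)) ++
    ((List.range h).reverse.map fun k => towerPt M a u (o + 1) (k + 1))

/-- The block of the run at index `t`: the run point, followed by the tower if `t` is a tower
offset. [folklore] -/
def runBlock (M : ℕ) (a u : GridPoint) (offs : List ℕ) (h t : ℕ) : List GridPoint :=
  runPt M a u t :: if t ∈ offs then tower M a u t h else []

/-- The blocks of the run from index `t` on, `n` of them. [folklore] -/
def runFrom (M : ℕ) (a u : GridPoint) (offs : List ℕ) (h : ℕ) : ℕ → ℕ → List GridPoint
  | _, 0 => []
  | t, n + 1 => runBlock M a u offs h t ++ runFrom M a u offs h (t + 1) n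

/-- **The run of the unit edge `(a, a + u)` enlarged by `M`, with towers** at the offsets
`offs` (indices `0, …, M - 1`; the end point `M (a + u)` is not included).
[cite: LiskiewiczOgiharaToda2003, §4 (proof of Theorem 7, E₂)] -/
def runWithTowers (M : ℕ) (a u : GridPoint) (offs : List ℕ) (h : ℕ) : List GridPoint :=
  runFrom M a u offs h 0 M

/-- **A path enlarged by `M`**: every unit edge becomes a straight run of `M` unit edges
("transforming each edge … to the straight line of length λ"). [cite: LiskiewiczOgiharaToda2003, §4 (proof of Theorem 7: enlarging by a factor)] -/
def scalePath (M : ℕ) : List GridPoint → List GridPoint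
  | [] => []
  | [p] => [(M : ℤ) • p]
  | p :: q :: l => runFrom M p (q - p) [] 1 0 M ++ scalePath M (q :: l)

/-- The tower offsets `8Λ + 2j`, `j < T` (every other edge of the middle third of the first
run). [cite: LiskiewiczOgiharaToda2003, §4 (proof of Theorem 7: "we replace for each i … the edge a(2i) by the tower")] -/
def towerOffsets (Λ T : ℕ) : List ℕ := (List.range T).map fun j => 8 * Λ + 2 * j

/-- **The new path**: the first unit edge enlarged with `T` towers of height `6Λ`, the other
unit edges enlarged plainly (factor `M = 24Λ`). [cite: LiskiewiczOgiharaToda2003, §4 (proof of Theorem 7, E₂)] -/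
def newPath (Λ T : ℕ) : List GridPoint → List GridPoint
  | p :: q :: l => runWithTowers (bigM Λ) p (q - p) (towerOffsets Λ T) (6 * Λ) ++ scalePath (bigM Λ) (q :: l)
  | π => scalePath (bigM Λ) π

/-! ### Lengths -/

/-- A tower has `2h` points. [folklore] -/
@[simp] theorem length_tower (M : ℕ) (a u : GridPoint) (o h : ℕ) : (tower M a u o h).length = 2 * h := by
  simp [tower]; ring

/-- Length of the blocks from `t` on: one run point per block plus `2h` per tower offset met.
[folklore] -/
theorem length_runFrom (M : ℕ) (a u : GridPoint) (offs : List ℕ) (h : ℕ) :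
    ∀ (n t : ℕ), (runFrom M a u offs h t n).length = n + 2 * h * ((List.range' t n).countP fun s => s ∈ offs)
  | 0, t => by simp [runFrom]
  | n + 1, t => by
    rw [runFrom, List.length_append, length_runFrom M a u offs h n (t + 1), List.range'_succ, List.countP_cons,
      runBlock]
    by_cases ht : t ∈ offs
    · simp only [ht, ↓reduceIte, List.length_cons, length_tower, decide_true]; ring
    · simp only [ht, ↓reduceIte, List.length_cons, List.length_nil, decide_false, Bool.false_eq_true]; ring

/-- The plain run has `M` points. [folklore] -/
theorem length_runFrom_nil (M : ℕ) (a u : GridPoint) (h n t : ℕ) : (runFrom M a u [] h t n).length = n := by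
  rw [length_runFrom]; simp

/-- Length of a scaled path: `M` points per unit edge, plus the last point. [folklore] -/
theorem length_scalePath (M : ℕ) : ∀ (p : GridPoint) (l : List GridPoint),
    (scalePath M (p :: l)).length = M * l.length + 1
  | p, [] => rfl
  | p, q :: l => by
    rw [scalePath, List.length_append, length_runFrom_nil, length_scalePath M q l, List.length_cons]; ring

/-- The tower offsets are `T` distinct numbers. [folklore] -/
theorem nodup_towerOffsets (Λ T : ℕ) : (towerOffsets Λ T).Nodup := by
  refine List.Nodup.map_on (fun i _ j _ h => by omega) (List.nodup_range)

/-- Membership in the tower offsets. [folklore] -/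
theorem mem_towerOffsets {Λ T o : ℕ} : o ∈ towerOffsets Λ T ↔ ∃ j < T, o = 8 * Λ + 2 * j := by
  simp [towerOffsets, eq_comm]

/-- Counting the members of a list of distinct numbers below `M` among `0, …, M - 1` gives its
length. [folklore] -/
theorem countP_mem_range {offs : List ℕ} {M : ℕ} (hnd : offs.Nodup) (hlt : ∀ o ∈ offs, o < M) :
    ((List.range' 0 M).countP fun s => s ∈ offs) = offs.length := by
  rw [List.countP_eq_length_filter]
  have hperm : ((List.range' 0 M).filter fun s => decide (s ∈ offs)).Perm offs := by
    refine (List.perm_ext_iff_of_nodup ((List.nodup_range' (step := 1) (by omega)).filter _) hnd).2 fun s => ?_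
    simp only [List.mem_filter, List.mem_range'_1, decide_eq_true_eq, Nat.zero_le, true_and, zero_add]
    exact ⟨fun h => h.2, fun h => ⟨hlt s h, h⟩⟩
  exact hperm.length_eq

/-- **Length of the new path**: with `λ + 1` points in `π` (`λ ≥ 1` unit edges, `λ ≤ Λ`) and
`T = 2 (Λ - λ)` towers of height `6Λ`, the new path has `24 Λ² + 1` points — every edge is
realised by a path of the same length `ℓ = 24 Λ²`. [cite: LiskiewiczOgiharaToda2003, §4 (proof of Theorem 7: "for all edges e of G′, e is realized by a path of length L²")] -/
theorem length_newPath {Λ : ℕ} (p q : GridPoint) (l : List GridPoint) (hlam : l.length + 1 ≤ Λ) :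
    (newPath Λ (2 * (Λ - (l.length + 1))) (p :: q :: l)).length = 24 * Λ * Λ + 1 := by
  rw [newPath, List.length_append, runWithTowers, length_runFrom, length_scalePath,
    countP_mem_range (nodup_towerOffsets _ _) (fun o ho => by
      obtain ⟨j, hj, rfl⟩ := mem_towerOffsets.1 ho; unfold bigM; omega)]
  simp only [towerOffsets, List.length_map, List.length_range, bigM]
  have h1 : l.length + 1 ≤ Λ := hlam
  zify [h1, Nat.sub_le]
  ring_nf

/-! ### Membership -/

/-- The points of a tower. [folklore] -/
theorem mem_tower {M : ℕ} {a u : GridPoint} {o h : ℕ} {X : GridPoint} :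
    X ∈ tower M a u o h ↔ ∃ k, 1 ≤ k ∧ k ≤ h ∧ (X = towerPt M a u o k ∨ X = towerPt M a u (o + 1) k) := by
  simp only [tower, List.mem_append, List.mem_map, List.mem_range, List.mem_reverse]
  constructor
  · rintro (⟨k, hk, rfl⟩ | ⟨k, hk, rfl⟩)
    · exact ⟨k + 1, by omega, by omega, Or.inl rfl⟩
    · exact ⟨k + 1, by omega, by omega, Or.inr rfl⟩
  · rintro ⟨k, hk1, hkh, rfl | rfl⟩
    · exact Or.inl ⟨k - 1, by omega, by rw [Nat.sub_add_cancel hk1]⟩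
    · exact Or.inr ⟨k - 1, by omega, by rw [Nat.sub_add_cancel hk1]⟩

/-- The points of the blocks from `t` on. [folklore] -/
theorem mem_runFrom {M : ℕ} {a u : GridPoint} {offs : List ℕ} {h : ℕ} {X : GridPoint} :
    ∀ {n t : ℕ}, X ∈ runFrom M a u offs h t n ↔
      ∃ s, t ≤ s ∧ s < t + n ∧ (X = runPt M a u s ∨ (s ∈ offs ∧ X ∈ tower M a u s h))
  | 0, t => by
    simp only [runFrom, List.not_mem_nil, add_zero, false_iff, not_exists, not_and]
    intro s hs hs'; omega
  | n + 1, t => by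
    rw [runFrom, List.mem_append, mem_runFrom, runBlock, List.mem_cons]
    constructor
    · rintro ((rfl | hX) | ⟨s, hs, hs', hX⟩)
      · exact ⟨t, le_rfl, by omega, Or.inl rfl⟩
      · refine ⟨t, le_rfl, by omega, Or.inr ?_⟩
        split_ifs at hX with ht
        · exact ⟨ht, hX⟩
        · simp at hX
      · exact ⟨s, by omega, by omega, hX⟩
    · rintro ⟨s, hs, hs', hX⟩
      rcases Nat.eq_or_lt_of_le hs with rfl | hlt
      · rcases hX with rfl | ⟨ht, hX⟩
        · exact Or.inl (Or.inl rfl)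
        · exact Or.inl (Or.inr (by rw [if_pos ht]; exact hX))
      · exact Or.inr ⟨s, hlt, by omega, hX⟩

/-- The points of a plain run: `runPt s`, `t ≤ s < t + n`. [folklore] -/
theorem mem_runFrom_nil {M : ℕ} {a u : GridPoint} {h n t : ℕ} {X : GridPoint} :
    X ∈ runFrom M a u [] h t n ↔ ∃ s, t ≤ s ∧ s < t + n ∧ X = runPt M a u s := by
  rw [mem_runFrom]; simp

/-- **The points of a scaled path**: run points `runPt M π[i] (π[i+1] - π[i]) s`, `s < M`, of
its unit edges, and the scaled last point. [folklore] -/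
theorem mem_scalePath {M : ℕ} {X : GridPoint} : ∀ (p : GridPoint) (l : List GridPoint),
    X ∈ scalePath M (p :: l) ↔
      (∃ i : ℕ, ∃ hi : i + 1 < (p :: l).length, ∃ s < M,
        X = runPt M ((p :: l)[i]'(by omega)) ((p :: l)[i + 1] - (p :: l)[i]'(by omega)) s) ∨
      X = (M : ℤ) • (p :: l).getLast (List.cons_ne_nil p l)
  | p, [] => by simp [scalePath]
  | p, q :: l => by
    rw [scalePath, List.mem_append, mem_runFrom_nil, mem_scalePath q l, List.getLast_cons_cons]
    constructor
    · rintro (⟨s, -, hs, rfl⟩ | ⟨i, hi, s, hs, rfl⟩ | h)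
      · exact Or.inl ⟨0, by simp, s, by omega, by simp⟩
      · exact Or.inl ⟨i + 1, by simpa using hi, s, hs, by simp⟩
      · exact Or.inr h
    · rintro (⟨i, hi, s, hs, rfl⟩ | h)
      · cases i with
        | zero => exact Or.inl ⟨s, Nat.zero_le _, by omega, by simp⟩
        | succ i => exact Or.inr (Or.inl ⟨i, by simpa using hi, s, hs, by simp⟩)
      · exact Or.inr (Or.inr h)

/-- **The points of the new path**: those of the scaled path, and the tower points of the first
run. [folklore] -/
theorem mem_newPath {Λ T : ℕ} {X : GridPoint} (p q : GridPoint) (l : List GridPoint) :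
    X ∈ newPath Λ T (p :: q :: l) ↔ X ∈ scalePath (bigM Λ) (p :: q :: l) ∨
      ∃ o ∈ towerOffsets Λ T, o < bigM Λ ∧ X ∈ tower (bigM Λ) p (q - p) o (6 * Λ) := by
  rw [newPath, List.mem_append, runWithTowers, mem_runFrom, scalePath, List.mem_append, mem_runFrom_nil]
  constructor
  · rintro (⟨s, -, hs, rfl | ⟨ho, hX⟩⟩ | h)
    · exact Or.inl (Or.inl ⟨s, Nat.zero_le _, hs, rfl⟩)
    · exact Or.inr ⟨s, ho, by omega, hX⟩
    · exact Or.inl (Or.inr h)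
  · rintro ((⟨s, -, hs, rfl⟩ | h) | ⟨o, ho, hoM, hX⟩)
    · exact Or.inl ⟨s, Nat.zero_le _, hs, Or.inl rfl⟩
    · exact Or.inr h
    · exact Or.inl ⟨o, by omega, by omega, Or.inr ⟨ho, hX⟩⟩

/-! ### Points over one base: run versus tower, tower versus tower -/

/-- Over one base and direction, a run point is not a tower point (towers have positive height).
[folklore] -/
theorem runPt_ne_towerPt_same (M : ℕ) (a : GridPoint) {u : GridPoint} (hu : IsUnitVec u) (t c : ℕ) {k : ℕ}
    (hk : 1 ≤ k) : runPt M a u t ≠ towerPt M a u c k := by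
  intro h
  have hx := congrArg Prod.fst h; have hy := congrArg Prod.snd h
  rw [runPt_fst, towerPt_fst] at hx; rw [runPt_snd, towerPt_snd] at hy
  rcases hu.cases with ⟨h1, h2⟩ | ⟨h1, h2⟩ | ⟨h1, h2⟩ | ⟨h1, h2⟩ <;>
    simp only [h1, h2, mul_one, mul_zero, mul_neg, add_zero, sub_zero] at hx hy <;> omega

/-- Over one base and direction, tower points determine column and height. [folklore] -/
theorem towerPt_inj_same (M : ℕ) (a : GridPoint) {u : GridPoint} (hu : IsUnitVec u) {c k c' k' : ℕ}
    (h : towerPt M a u c k = towerPt M a u c' k') : c = c' ∧ k = k' := by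
  have hx := congrArg Prod.fst h; have hy := congrArg Prod.snd h
  rw [towerPt_fst, towerPt_fst] at hx; rw [towerPt_snd, towerPt_snd] at hy
  rcases hu.cases with ⟨h1, h2⟩ | ⟨h1, h2⟩ | ⟨h1, h2⟩ | ⟨h1, h2⟩ <;>
    simp only [h1, h2, mul_one, mul_zero, mul_neg, add_zero, sub_zero] at hx hy <;> omega

/-- Run points are injective in the index (the direction is nonzero). [folklore] -/
theorem runPt_injective (M : ℕ) (a : GridPoint) {u : GridPoint} (hu : IsUnitVec u) :
    Function.Injective (runPt M a u) := by
  intro t t' h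
  have hx := congrArg Prod.fst h; have hy := congrArg Prod.snd h
  rw [runPt_fst, runPt_fst] at hx; rw [runPt_snd, runPt_snd] at hy
  rcases hu.cases with ⟨h1, h2⟩ | ⟨h1, h2⟩ | ⟨h1, h2⟩ | ⟨h1, h2⟩ <;>
    simp only [h1, h2, mul_one, mul_zero, mul_neg] at hx hy <;> omega

/-- **A tower has no repeated point.** [folklore] -/
theorem nodup_tower (M : ℕ) (a : GridPoint) {u : GridPoint} (hu : IsUnitVec u) (o h : ℕ) :
    (tower M a u o h).Nodup := by
  rw [tower, List.nodup_append]
  refine ⟨?_, ?_, ?_⟩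
  · exact (List.nodup_range).map fun k k' hk => by
      have := (towerPt_inj_same M a hu hk).2; omega
  · exact (List.nodup_reverse.2 List.nodup_range).map fun k k' hk => by
      have := (towerPt_inj_same M a hu hk).2; omega
  · simp only [List.mem_map, List.mem_range, List.mem_reverse]
    rintro _ ⟨k, -, rfl⟩ _ ⟨k', -, rfl⟩ h
    have := (towerPt_inj_same M a hu h).1; omega

/-- **The run with towers has no repeated point**, provided no two tower offsets are consecutive
(the offsets `8Λ + 2j` are not). [folklore] -/
theorem nodup_runFrom (M : ℕ) (a : GridPoint) {u : GridPoint} (hu : IsUnitVec u) {offs : List ℕ}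
    (hsp : ∀ o ∈ offs, o + 1 ∉ offs) (h : ℕ) :
    ∀ (n t : ℕ), (runFrom M a u offs h t n).Nodup
  | 0, t => List.nodup_nil
  | n + 1, t => by
    rw [runFrom, List.nodup_append]
    refine ⟨?_, nodup_runFrom M a hu hsp h n (t + 1), ?_⟩
    · rw [runBlock, List.nodup_cons]
      refine ⟨fun hX => ?_, ?_⟩
      · split_ifs at hX with ht
        · obtain ⟨k, hk1, -, hk | hk⟩ := mem_tower.1 hX
          · exact runPt_ne_towerPt_same M a hu t t hk1 hk
          · exact runPt_ne_towerPt_same M a hu t (t + 1) hk1 hk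
        · simp at hX
      · split_ifs
        · exact nodup_tower M a hu t h
        · exact List.nodup_nil
    · intro X hX Y hY hXY
      subst hXY
      rw [runBlock, List.mem_cons] at hX
      obtain ⟨s, hs, -, hY⟩ := mem_runFrom.1 hY
      rcases hX with rfl | hX
      · rcases hY with hY | ⟨-, hY⟩
        · have := runPt_injective M a hu hY; omega
        · obtain ⟨k, hk1, -, hk | hk⟩ := mem_tower.1 hY
          · exact runPt_ne_towerPt_same M a hu t s hk1 hk
          · exact runPt_ne_towerPt_same M a hu t (s + 1) hk1 hk
      · split_ifs at hX with ht
        · obtain ⟨k, hk1, -, rfl | rfl⟩ := mem_tower.1 hX <;> rcases hY with hY | ⟨hs', hY⟩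
          · exact runPt_ne_towerPt_same M a hu s t hk1 hY.symm
          · obtain ⟨k', -, -, hk' | hk'⟩ := mem_tower.1 hY
            · have := (towerPt_inj_same M a hu hk').1; omega
            · have := (towerPt_inj_same M a hu hk').1; omega
          · exact runPt_ne_towerPt_same M a hu s (t + 1) hk1 hY.symm
          · obtain ⟨k', -, -, hk' | hk'⟩ := mem_tower.1 hY
            · have := (towerPt_inj_same M a hu hk').1
              exact hsp t ht (this ▸ hs')
            · have := (towerPt_inj_same M a hu hk').1; omega
        · simp at hX

/-! ### Run points of a self-avoiding unit path -/

section Path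

variable {M : ℕ} {π : List GridPoint}

/-- The direction of the `i`-th unit edge of a grid path is a unit vector. [folklore] -/
theorem isUnitVec_step (hch : List.IsChain IsGridEdge π) {i : ℕ} (hi : i + 1 < π.length) :
    IsUnitVec (π[i + 1] - π[i]'(Nat.lt_of_succ_lt hi)) :=
  (isGridEdge_iff_isUnitVec _ _).1 (List.isChain_iff_getElem.1 hch i hi)

/-- **Run points of distinct unit edges of a self-avoiding grid path are distinct** (indices
`< M`): a self-avoiding path traverses no unit edge twice, in either direction. [folklore] -/
theorem runPt_path_eq (hnd : π.Nodup) (hch : List.IsChain IsGridEdge π) {i j s s' : ℕ}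
    (hi : i + 1 < π.length) (hj : j + 1 < π.length) (hs : s < M) (hs' : s' < M)
    (h : runPt M (π[i]'(Nat.lt_of_succ_lt hi)) (π[i + 1] - π[i]'(Nat.lt_of_succ_lt hi)) s =
      runPt M (π[j]'(Nat.lt_of_succ_lt hj)) (π[j + 1] - π[j]'(Nat.lt_of_succ_lt hj)) s') :
    i = j ∧ s = s' := by
  rcases runPt_eq_runPt (isUnitVec_step hch hi) (isUnitVec_step hch hj) hs hs' h with
    ⟨rfl, rfl, he⟩ | ⟨-, rfl, he, -⟩ | ⟨-, -, he, hu, -⟩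
  · exact ⟨(hnd.getElem_inj_iff).1 he, rfl⟩
  · exact ⟨(hnd.getElem_inj_iff).1 he, rfl⟩
  · exfalso
    have h1 : π[j]'(Nat.lt_of_succ_lt hj) = π[i + 1] := by rw [he]; abel
    have h2 : π[j + 1] = π[i]'(Nat.lt_of_succ_lt hi) := by
      have : π[j + 1] = π[j]'(Nat.lt_of_succ_lt hj) + (π[j + 1] - π[j]'(Nat.lt_of_succ_lt hj)) := by abel
      rw [this, hu, h1]; abel
    have e1 := (hnd.getElem_inj_iff).1 h1
    have e2 := (hnd.getElem_inj_iff).1 h2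
    omega

/-- A run point with index `< M` is not the scaled last point of the path. [folklore] -/
theorem runPt_path_ne_last (hnd : π.Nodup) (hch : List.IsChain IsGridEdge π) {i s : ℕ}
    (hi : i + 1 < π.length) (hs : s < M) (hne : π ≠ []) :
    runPt M (π[i]'(Nat.lt_of_succ_lt hi)) (π[i + 1] - π[i]'(Nat.lt_of_succ_lt hi)) s ≠ (M : ℤ) • π.getLast hne := by
  intro h
  obtain ⟨-, he⟩ := smul_eq_runPt (isUnitVec_step hch hi) hs h.symm
  rw [List.getLast_eq_getElem] at he
  have := (hnd.getElem_inj_iff).1 he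
  omega

/-- **A scaled self-avoiding grid path has no repeated point.** [folklore] -/
theorem nodup_scalePath : ∀ (p : GridPoint) (l : List GridPoint), (p :: l).Nodup →
    List.IsChain IsGridEdge (p :: l) → (scalePath M (p :: l)).Nodup
  | p, [], _, _ => List.nodup_singleton _
  | p, q :: l, hnd, hch => by
    rw [scalePath, List.nodup_append]
    have hu : IsUnitVec (q - p) := (isGridEdge_iff_isUnitVec _ _).1 (List.isChain_cons_cons.1 hch).1
    refine ⟨nodup_runFrom M p hu (offs := []) (by simp) 1 M 0, nodup_scalePath q l hnd.of_cons
      (List.isChain_cons_cons.1 hch).2, ?_⟩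
    intro X hX Y hY hXY
    subst hXY
    obtain ⟨s, -, hs, rfl⟩ := mem_runFrom_nil.1 hX
    rcases (mem_scalePath q l).1 hY with ⟨i, hi, s', hs', h⟩ | h
    · have h' := runPt_path_eq (π := p :: q :: l) hnd hch (i := 0) (j := i + 1) (by simp) (by simpa using hi)
        (by simpa using hs) hs' (by simpa using h)
      omega
    · exact runPt_path_ne_last (π := p :: q :: l) hnd hch (i := 0) (by simp) (by simpa using hs)
        (List.cons_ne_nil _ _) (by simpa using h)

/-- Consecutive tower offsets do not occur. [folklore] -/
theorem towerOffsets_spaced (Λ T : ℕ) : ∀ o ∈ towerOffsets Λ T, o + 1 ∉ towerOffsets Λ T := by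
  intro o ho ho'
  obtain ⟨j, -, rfl⟩ := mem_towerOffsets.1 ho
  obtain ⟨j', -, h⟩ := mem_towerOffsets.1 ho'
  omega

/-- The windows of the tower points of the first run: columns in `[8Λ, 12Λ)` (for `T ≤ 2Λ`).
[folklore] -/
theorem towerOffsets_window {Λ T o : ℕ} (hT : T ≤ 2 * Λ) (ho : o ∈ towerOffsets Λ T) :
    8 * Λ ≤ o ∧ o + 1 < 12 * Λ := by
  obtain ⟨j, hj, rfl⟩ := mem_towerOffsets.1 ho; omega

/-- **The new path has no repeated point** (for a self-avoiding unit path, `T ≤ 2Λ` towers).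
[cite: LiskiewiczOgiharaToda2003, §4 (proof of Theorem 7: the towers do "not interfere")] -/
theorem nodup_newPath {Λ T : ℕ} (hT : T ≤ 2 * Λ) (p q : GridPoint) (l : List GridPoint)
    (hnd : (p :: q :: l).Nodup) (hch : List.IsChain IsGridEdge (p :: q :: l)) :
    (newPath Λ T (p :: q :: l)).Nodup := by
  rw [newPath, List.nodup_append]
  have hu : IsUnitVec (q - p) := (isGridEdge_iff_isUnitVec _ _).1 (List.isChain_cons_cons.1 hch).1
  refine ⟨nodup_runFrom _ p hu (towerOffsets_spaced Λ T) _ _ 0, nodup_scalePath q l hnd.of_cons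
    (List.isChain_cons_cons.1 hch).2, ?_⟩
  intro X hX Y hY hXY
  subst hXY
  rw [runWithTowers, mem_runFrom] at hX
  obtain ⟨s, -, hs, rfl | ⟨ho, hX⟩⟩ := hX
  · -- a run point of the first edge
    rcases (mem_scalePath q l).1 hY with ⟨i, hi, s', hs', h⟩ | h
    · have h' := runPt_path_eq (π := p :: q :: l) hnd hch (i := 0) (j := i + 1) (by simp) (by simpa using hi)
        (by simpa using hs) hs' (by simpa using h)
      omega
    · exact runPt_path_ne_last (π := p :: q :: l) hnd hch (i := 0) (by simp) (by simpa using hs)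
        (List.cons_ne_nil _ _) (by simpa using h)
  · -- a tower point
    obtain ⟨hlo, hhi⟩ := towerOffsets_window hT ho
    obtain ⟨k, hk1, hk, rfl | rfl⟩ := mem_tower.1 hX <;> rcases (mem_scalePath q l).1 hY with ⟨i, hi, s', -, h⟩ | h
    · exact towerPt_ne_runPt hu p hlo (by omega) hk1 hk (isUnitVec_step (π := q :: l)
        (List.isChain_cons_cons.1 hch).2 hi) _ s' h
    · exact towerPt_ne_smul hu p hlo (by omega) hk1 hk _ h
    · exact towerPt_ne_runPt hu p (by omega) hhi hk1 hk (isUnitVec_step (π := q :: l)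
        (List.isChain_cons_cons.1 hch).2 hi) _ s' h
    · exact towerPt_ne_smul hu p (by omega) hhi hk1 hk _ h

end Path

/-! ### Chains and ends -/

/-- A tower is a chain of grid edges. [folklore] -/
theorem isChain_tower (M : ℕ) (a : GridPoint) {u : GridPoint} (hu : IsUnitVec u) (o h : ℕ) :
    List.IsChain IsGridEdge (tower M a u o h) := by
  cases h with
  | zero => simp [tower]
  | succ h =>
    rw [tower, List.isChain_append]
    refine ⟨?_, ?_, ?_⟩
    · exact List.isChain_map_of_isChain (R := fun k k' : ℕ => k' = k + 1) _
        (fun k k' hk => by subst hk; exact isGridEdge_towerPt_succ M a hu o (k + 1))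
        ((List.isChain_range_succ _ _).2 fun _ _ => rfl)
    · rw [List.map_reverse, List.isChain_reverse]
      exact List.isChain_map_of_isChain (R := fun k k' : ℕ => k' = k + 1) _
        (fun k k' hk => by subst hk; exact (isGridEdge_towerPt_succ M a hu (o + 1) (k + 1)).symm)
        ((List.isChain_range_succ _ _).2 fun _ _ => rfl)
    · intro x hx y hy
      rw [List.getLast?_map, List.getLast?_range] at hx
      rw [List.head?_map, List.head?_reverse, List.getLast?_range] at hy
      simp only [Nat.add_one_ne_zero, ↓reduceIte, Nat.add_sub_cancel, Option.map_some, Option.mem_def,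
        Option.some.injEq] at hx hy
      subst hx; subst hy
      exact isGridEdge_towerPt_top M a hu o (h + 1)

/-- The first point of a (non-empty) tower. [folklore] -/
theorem head?_tower (M : ℕ) (a u : GridPoint) (o : ℕ) {h : ℕ} (hh : 1 ≤ h) :
    (tower M a u o h).head? = some (towerPt M a u o 1) := by
  obtain ⟨h, rfl⟩ : ∃ h', h = h' + 1 := ⟨h - 1, by omega⟩
  simp [tower, List.range_succ_eq_map]

/-- The last point of a (non-empty) tower. [folklore] -/
theorem getLast?_tower (M : ℕ) (a u : GridPoint) (o : ℕ) {h : ℕ} (hh : 1 ≤ h) :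
    (tower M a u o h).getLast? = some (towerPt M a u (o + 1) 1) := by
  obtain ⟨h, rfl⟩ : ∃ h', h = h' + 1 := ⟨h - 1, by omega⟩
  rw [tower, List.getLast?_append, List.map_reverse, List.getLast?_reverse]
  simp [List.range_succ_eq_map]

/-- The blocks from `t` on start with the run point `t`. [folklore] -/
theorem head?_runFrom (M : ℕ) (a u : GridPoint) (offs : List ℕ) (h t : ℕ) {n : ℕ} (hn : 1 ≤ n) :
    (runFrom M a u offs h t n).head? = some (runPt M a u t) := by
  obtain ⟨n, rfl⟩ : ∃ n', n = n' + 1 := ⟨n - 1, by omega⟩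
  simp [runFrom, runBlock]

/-- **The last point of the blocks from `t` on is adjacent to the run point `t + n`** (whether
or not the last block carries a tower). [folklore] -/
theorem isGridEdge_getLast_runFrom (M : ℕ) (a : GridPoint) {u : GridPoint} (hu : IsUnitVec u) (offs : List ℕ)
    {h : ℕ} (hh : 1 ≤ h) : ∀ {n : ℕ} (t : ℕ), ∀ x ∈ (runFrom M a u offs h t n).getLast?, 1 ≤ n →
      IsGridEdge x (runPt M a u (t + n))
  | 0, t, x, hx, hn => by omega
  | n + 1, t, x, hx, _ => by
    rw [runFrom, List.getLast?_append] at hx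
    rcases Nat.eq_zero_or_pos n with rfl | hn
    · simp only [runFrom, List.getLast?_nil, Option.none_or, runBlock] at hx
      split_ifs at hx with ht
      · rw [List.getLast?_cons, getLast?_tower M a u t hh] at hx
        simp only [Option.getD_some, Option.mem_def, Option.some.injEq] at hx
        subst hx
        exact (isGridEdge_runPt_towerPt M a hu (t + 1)).symm
      · simp only [List.getLast?_singleton, Option.mem_def, Option.some.injEq] at hx
        subst hx
        exact isGridEdge_runPt_succ M a hu t
    · have hne : runFrom M a u offs h (t + 1) n ≠ [] := by
        intro he; have := congrArg List.length he; rw [length_runFrom] at this; simp at this; omega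
      obtain ⟨a', ha'⟩ : ∃ a', (runFrom M a u offs h (t + 1) n).getLast? = some a' :=
        Option.isSome_iff_exists.1 (List.getLast?_isSome.2 hne)
      rw [ha', Option.some_or] at hx
      simp only [Option.mem_def, Option.some.injEq] at hx
      subst hx
      have := isGridEdge_getLast_runFrom M a hu offs hh (t + 1) a' (by rw [ha']; rfl) hn
      rwa [show t + 1 + n = t + (n + 1) by omega] at this

/-- A block is a chain: the run point, then (possibly) its tower. [folklore] -/
theorem isChain_runBlock (M : ℕ) (a : GridPoint) {u : GridPoint} (hu : IsUnitVec u) (offs : List ℕ) {h : ℕ}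
    (hh : 1 ≤ h) (t : ℕ) : List.IsChain IsGridEdge (runBlock M a u offs h t) := by
  rw [runBlock]
  split_ifs
  · refine List.IsChain.cons (isChain_tower M a hu t h) fun y hy => ?_
    rw [head?_tower M a u t hh] at hy
    simp only [Option.mem_def, Option.some.injEq] at hy
    subst hy; exact isGridEdge_runPt_towerPt M a hu t
  · exact List.IsChain.singleton _

/-- **The run with towers is a chain of grid edges.** [folklore] -/
theorem isChain_runFrom (M : ℕ) (a : GridPoint) {u : GridPoint} (hu : IsUnitVec u) (offs : List ℕ) {h : ℕ}
    (hh : 1 ≤ h) : ∀ (n t : ℕ), List.IsChain IsGridEdge (runFrom M a u offs h t n)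
  | 0, _ => List.IsChain.nil
  | n + 1, t => by
    rw [runFrom, List.isChain_append]
    refine ⟨isChain_runBlock M a hu offs hh t, isChain_runFrom M a hu offs hh n (t + 1), fun x hx y hy => ?_⟩
    rcases Nat.eq_zero_or_pos n with rfl | hn
    · simp [runFrom] at hy
    · rw [head?_runFrom M a u offs h (t + 1) hn] at hy
      simp only [Option.mem_def, Option.some.injEq] at hy
      subst hy
      have := isGridEdge_getLast_runFrom M a hu offs hh (n := 1) t x (by simpa [runFrom] using hx) le_rfl
      exact this

/-- The first point of a scaled path. [folklore] -/
theorem head?_scalePath {M : ℕ} (hM : 1 ≤ M) : ∀ (p : GridPoint) (l : List GridPoint),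
    (scalePath M (p :: l)).head? = some ((M : ℤ) • p)
  | p, [] => rfl
  | p, q :: l => by
    rw [scalePath, List.head?_append, head?_runFrom M p (q - p) [] 1 0 hM, runPt_zero]; rfl

/-- The last point of a scaled path. [folklore] -/
theorem getLast?_scalePath {M : ℕ} : ∀ (p : GridPoint) (l : List GridPoint),
    (scalePath M (p :: l)).getLast? = some ((M : ℤ) • (p :: l).getLast (List.cons_ne_nil p l))
  | p, [] => rfl
  | p, q :: l => by
    rw [scalePath, List.getLast?_append, getLast?_scalePath q l, List.getLast_cons_cons]; rfl

/-- **A scaled grid path is a chain of grid edges.** [folklore] -/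
theorem isChain_scalePath {M : ℕ} (hM : 1 ≤ M) : ∀ (p : GridPoint) (l : List GridPoint),
    List.IsChain IsGridEdge (p :: l) → List.IsChain IsGridEdge (scalePath M (p :: l))
  | p, [], _ => List.IsChain.singleton _
  | p, q :: l, hch => by
    have hu : IsUnitVec (q - p) := (isGridEdge_iff_isUnitVec _ _).1 (List.isChain_cons_cons.1 hch).1
    rw [scalePath, List.isChain_append]
    refine ⟨isChain_runFrom M p hu [] le_rfl M 0, isChain_scalePath hM q l (List.isChain_cons_cons.1 hch).2,
      fun x hx y hy => ?_⟩
    rw [head?_scalePath hM] at hy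
    simp only [Option.mem_def, Option.some.injEq] at hy
    subst hy
    have := isGridEdge_getLast_runFrom M p hu [] (h := 1) le_rfl 0 x hx hM
    rwa [Nat.zero_add, runPt_self, add_sub_cancel] at this

/-- **The new path is a chain of grid edges** (`Λ ≥ 1`). [cite: LiskiewiczOgiharaToda2003, §4 (proof of Theorem 7, E₂)] -/
theorem isChain_newPath {Λ T : ℕ} (hΛ : 1 ≤ Λ) (p q : GridPoint) (l : List GridPoint)
    (hch : List.IsChain IsGridEdge (p :: q :: l)) : List.IsChain IsGridEdge (newPath Λ T (p :: q :: l)) := by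
  have hu : IsUnitVec (q - p) := (isGridEdge_iff_isUnitVec _ _).1 (List.isChain_cons_cons.1 hch).1
  have hM : 1 ≤ bigM Λ := by unfold bigM; omega
  rw [newPath, List.isChain_append]
  refine ⟨isChain_runFrom _ p hu _ (by omega) _ 0, isChain_scalePath hM q l (List.isChain_cons_cons.1 hch).2,
    fun x hx y hy => ?_⟩
  rw [head?_scalePath hM] at hy
  simp only [Option.mem_def, Option.some.injEq] at hy
  subst hy
  have := isGridEdge_getLast_runFrom (bigM Λ) p hu (towerOffsets Λ T) (h := 6 * Λ) (by omega) 0 x hx hM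
  rwa [Nat.zero_add, runPt_self, add_sub_cancel] at this

/-- The first point of the new path is the scaled first point. [folklore] -/
theorem head?_newPath {Λ T : ℕ} (hΛ : 1 ≤ Λ) (p q : GridPoint) (l : List GridPoint) :
    (newPath Λ T (p :: q :: l)).head? = some ((bigM Λ : ℤ) • p) := by
  rw [newPath, List.head?_append, runWithTowers, head?_runFrom _ _ _ _ _ _ (by unfold bigM; omega), runPt_zero]
  rfl

/-- The last point of the new path is the scaled last point. [folklore] -/
theorem getLast?_newPath {Λ T : ℕ} (p q : GridPoint) (l : List GridPoint) :
    (newPath Λ T (p :: q :: l)).getLast? = some ((bigM Λ : ℤ) • (p :: q :: l).getLast (List.cons_ne_nil _ _)) := by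
  rw [newPath, List.getLast?_append, getLast?_scalePath q l, List.getLast_cons_cons]; rfl

/-! ### The uniformised drawing -/

/-- The largest number of unit edges of a drawn path (at least `1`): `Λ`. [folklore] -/
def maxEdges (D : List DrawnEdge) : ℕ := D.foldr (fun e m => max (e.2.2.length - 1) m) 1

/-- `Λ ≥ 1`. [folklore] -/
theorem one_le_maxEdges (D : List DrawnEdge) : 1 ≤ maxEdges D := by
  induction D with
  | nil => exact le_rfl
  | cons e D ih => exact le_trans ih (le_max_right _ _)

/-- Every drawn path has at most `Λ` unit edges. [folklore] -/
theorem length_sub_one_le_maxEdges {D : List DrawnEdge} {e : DrawnEdge} (he : e ∈ D) : e.2.2.length - 1 ≤ maxEdges D := by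
  induction D with
  | nil => simp at he
  | cons e' D ih =>
    rcases List.mem_cons.1 he with rfl | he
    · exact le_max_left _ _
    · exact le_trans (ih he) (le_max_right _ _)

/-- The number of towers of the edge `e`: `2 (Λ - λ(e))`. [folklore] -/
def towerCount (Λ : ℕ) (e : DrawnEdge) : ℕ := 2 * (Λ - (e.2.2.length - 1))

/-- **The uniformised drawing** `(P₂, D₂)`: vertex images scaled by `M = 24Λ`, every edge
re-drawn by `newPath` (first unit edge with `2(Λ - λ(e))` towers of height `6Λ`, the rest scaled)
— all edges realised by paths of the same length `24Λ²` (`length_uniformize`); the analogue of the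
source's `E₀ ↦ E₁ ↦ E₂`. [cite: LiskiewiczOgiharaToda2003, §4 (proof of Theorem 7: E₁, E₂, "for all edges e of G′, e is realized by a path of length L²")] -/
def uniformize (P : List GridPoint) (D : List DrawnEdge) : List GridPoint × List DrawnEdge :=
  (P.map fun p => (bigM (maxEdges D) : ℤ) • p,
    D.map fun e => (e.1, e.2.1, newPath (maxEdges D) (towerCount (maxEdges D) e) e.2.2))

/-- The uniformised drawing has the same end pairs. [folklore] -/
theorem map_ends_uniformize (P : List GridPoint) (D : List DrawnEdge) :
    (uniformize P D).2.map (fun e => (e.1, e.2.1)) = D.map (fun e => (e.1, e.2.1)) := by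
  simp [uniformize]

/-- The uniformised drawing has as many vertices. [folklore] -/
@[simp] theorem length_uniformize_fst (P : List GridPoint) (D : List DrawnEdge) : (uniformize P D).1.length = P.length := by
  simp [uniformize]

section Drawing

variable {P : List GridPoint} {D : List DrawnEdge}

/-- A drawn path has the form `p :: q :: l`. [folklore] -/
theorem exists_eq_cons_cons_of_mem (hD : IsGridDrawing P D) {e : DrawnEdge} (he : e ∈ D) :
    ∃ p q l, e.2.2 = p :: q :: l := by
  have h := two_le_length_of_isDrawnEdgeOf hD.1 (hD.2.1 e he)
  match h' : e.2.2, h with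
  | p :: q :: l, _ => exact ⟨p, q, l, rfl⟩

/-- **Uniform length**: every edge of the uniformised drawing is realised by a path with
`24 Λ² + 1` points. [cite: LiskiewiczOgiharaToda2003, §4 (proof of Theorem 7: "e is realized by a path of length L²")] -/
theorem length_uniformize (hD : IsGridDrawing P D) :
    ∀ e ∈ (uniformize P D).2, e.2.2.length = 24 * maxEdges D * maxEdges D + 1 := by
  intro e₂ he₂
  obtain ⟨e, he, rfl⟩ := List.mem_map.1 he₂
  obtain ⟨p, q, l, hπ⟩ := exists_eq_cons_cons_of_mem hD he
  have hle := length_sub_one_le_maxEdges he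
  dsimp only
  rw [towerCount, hπ]
  rw [hπ] at hle
  simp only [List.length_cons, Nat.add_sub_cancel] at hle ⊢
  exact length_newPath p q l hle

/-- The tower count is at most `2Λ`. [folklore] -/
theorem towerCount_le (Λ : ℕ) (e : DrawnEdge) : towerCount Λ e ≤ 2 * Λ := by unfold towerCount; omega

/-- **Two distinct common points that are vertex images force equal ends.** If two correctly
drawn edges both pass through two distinct points of `P`, these are the two end images of both,
so the edges have the same ends. [folklore] -/
theorem sameEnds_of_two_common (hP : P.Nodup) {e e' : DrawnEdge} (hde : IsDrawnEdgeOf P e) (hde' : IsDrawnEdgeOf P e')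
    {x y : GridPoint} (hxy : x ≠ y) (hx : x ∈ e.2.2) (hx' : x ∈ e'.2.2) (hy : y ∈ e.2.2) (hy' : y ∈ e'.2.2)
    (hxP : x ∈ P) (hyP : y ∈ P) : SameEnds e e' := by
  obtain ⟨h1, h2, -, -, -, -, -, hint⟩ := hde
  obtain ⟨h1', h2', -, -, -, -, -, hint'⟩ := hde'
  have ax := hint x hx hxP; have ay := hint y hy hyP
  have bx := hint' x hx' hxP; have by' := hint' y hy' hyP
  have key : ∀ {i j : ℕ}, i < P.length → P[i]? = some x → P[j]? = some x → i = j := fun hi hx1 hx2 =>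
    (List.getElem?_inj hi hP).1 (hx1.trans hx2.symm)
  have keyy : ∀ {i j : ℕ}, i < P.length → P[i]? = some y → P[j]? = some y → i = j := fun hi hy1 hy2 =>
    (List.getElem?_inj hi hP).1 (hy1.trans hy2.symm)
  have nxy : ∀ {i : ℕ}, P[i]? = some x → P[i]? = some y → False := fun h h' =>
    hxy (Option.some.inj (h.symm.trans h'))
  unfold SameEnds
  rcases ax with ax | ax <;> rcases ay with ay | ay
  · exact (nxy ax ay).elim
  · rcases bx with bx | bx <;> rcases by' with by' | by'
    · exact (nxy bx by').elim
    · exact Or.inl ⟨key h1 ax bx, keyy h2 ay by'⟩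
    · exact Or.inr ⟨key h1 ax bx, keyy h2 ay by'⟩
    · exact (nxy bx by').elim
  · rcases bx with bx | bx <;> rcases by' with by' | by'
    · exact (nxy bx by').elim
    · exact Or.inr ⟨keyy h1 ay by', key h2 ax bx⟩
    · exact Or.inl ⟨keyy h1 ay by', key h2 ax bx⟩
    · exact (nxy bx by').elim
  · exact (nxy ax ay).elim

/-- Membership in the scaled vertex list. [folklore] -/
theorem mem_map_smul {c : ℤ} {X : GridPoint} : X ∈ P.map (fun p => c • p) ↔ ∃ p ∈ P, X = c • p := by
  simp [eq_comm]

/-- Indexing the scaled vertex list. [folklore] -/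
theorem getElem?_map_smul (c : ℤ) (i : ℕ) : (P.map fun p => c • p)[i]? = (P[i]?).map fun p => c • p :=
  List.getElem?_map

/-- A point of a drawn path that is a vertex image is an end image; scaled form. [folklore] -/
theorem end_of_mem_P {e : DrawnEdge} (hde : IsDrawnEdgeOf P e) {x : GridPoint} (hx : x ∈ e.2.2) (hxP : x ∈ P) (c : ℤ) :
    (P.map fun p => c • p)[e.1]? = some (c • x) ∨ (P.map fun p => c • p)[e.2.1]? = some (c • x) := by
  rcases hde.2.2.2.2.2.2.2 x hx hxP with h | h
  · left; rw [getElem?_map_smul, h]; rfl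
  · right; rw [getElem?_map_smul, h]; rfl

/-- The head of a drawn path is a vertex image. [folklore] -/
theorem head_mem_P {e : DrawnEdge} (hde : IsDrawnEdgeOf P e) {p : GridPoint} {l : List GridPoint} (hπ : e.2.2 = p :: l) :
    p ∈ P := by
  have h := hde.2.2.2.1
  rw [hπ, List.head?_cons] at h
  exact List.mem_of_getElem? h.symm

/-- The last point of a drawn path is a vertex image. [folklore] -/
theorem getLast_mem_P {e : DrawnEdge} (hde : IsDrawnEdgeOf P e) {p : GridPoint} {l : List GridPoint}
    (hπ : e.2.2 = p :: l) : (p :: l).getLast (List.cons_ne_nil p l) ∈ P := by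
  have h := hde.2.2.2.2.1
  rw [hπ, List.getLast?_eq_some_getLast (List.cons_ne_nil _ _)] at h
  exact List.mem_of_getElem? h.symm

/-- **The new edge is correctly drawn** with respect to the scaled vertex images.
[cite: LiskiewiczOgiharaToda2003, §4 (proof of Theorem 7, E₂)] -/
theorem isDrawnEdgeOf_newPath (hD : IsGridDrawing P D) {e : DrawnEdge} (he : e ∈ D) :
    IsDrawnEdgeOf (uniformize P D).1 (e.1, e.2.1, newPath (maxEdges D) (towerCount (maxEdges D) e) e.2.2) := by
  have hde := hD.2.1 e he
  have hΛ := one_le_maxEdges D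
  obtain ⟨p, q, l, hπ⟩ := exists_eq_cons_cons_of_mem hD he
  obtain ⟨h1, h2, hne, hhead, hlast, hnd, hch, hint⟩ := hde
  rw [hπ] at hhead hlast hnd hch
  have hT : towerCount (maxEdges D) e ≤ 2 * maxEdges D := towerCount_le _ _
  refine ⟨by simpa [uniformize] using h1, by simpa [uniformize] using h2, hne, ?_, ?_, ?_, ?_, ?_⟩
  · dsimp only; rw [hπ, head?_newPath hΛ, uniformize, getElem?_map_smul, ← hhead]; rfl
  · dsimp only; rw [hπ, getLast?_newPath, uniformize, getElem?_map_smul, ← hlast, List.getLast?_eq_some_getLast]; rfl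
  · dsimp only; rw [hπ]; exact nodup_newPath hT p q l hnd hch
  · dsimp only; rw [hπ]; exact isChain_newPath hΛ p q l hch
  · dsimp only
    intro X hX hXP
    rw [hπ] at hX
    rw [uniformize] at hXP ⊢
    dsimp only at hXP ⊢
    obtain ⟨x, hxP, rfl⟩ := mem_map_smul.1 hXP
    rcases (mem_newPath p q l).1 hX with hX | ⟨o, ho, -, hX⟩
    · rcases (mem_scalePath p (q :: l)).1 hX with ⟨i, hi, s', hs', h⟩ | h
      · obtain ⟨rfl, rfl⟩ := smul_eq_runPt (isUnitVec_step hch hi) hs' h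
        have hmem : (p :: q :: l)[i]'(Nat.lt_of_succ_lt hi) ∈ e.2.2 := by rw [hπ]; exact List.getElem_mem _
        exact end_of_mem_P (hD.2.1 e he) hmem hxP _
      · have hM : ((bigM (maxEdges D) : ℕ) : ℤ) ≠ 0 := by unfold bigM; push_cast; omega
        have hx : x = (p :: q :: l).getLast (List.cons_ne_nil _ _) := smul_right_injective _ hM h
        have hmem : x ∈ e.2.2 := by rw [hx, hπ]; exact List.getLast_mem _
        exact end_of_mem_P (hD.2.1 e he) hmem hxP _
    · exfalso
      obtain ⟨hlo, hhi⟩ := towerOffsets_window hT ho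
      have hu : IsUnitVec (q - p) := (isGridEdge_iff_isUnitVec _ _).1 (List.isChain_cons_cons.1 hch).1
      obtain ⟨k, hk1, hk, h | h⟩ := mem_tower.1 hX
      · exact towerPt_ne_smul hu p hlo (by omega) hk1 hk x h.symm
      · exact towerPt_ne_smul hu p (by omega) hhi hk1 hk x h.symm

/-- **Two new edges meet only in scaled vertex images** (for original edges with different ends
meeting only in vertex images). [cite: LiskiewiczOgiharaToda2003, §4 (proof of Theorem 7: the towers do "not interfere with the other paths")] -/
theorem newPath_common (hD : IsGridDrawing P D) {e e' : DrawnEdge} (he : e ∈ D) (he' : e' ∈ D)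
    (hns : ¬ SameEnds e e') (hcf : ∀ x ∈ e.2.2, x ∈ e'.2.2 → x ∈ P) :
    ∀ X ∈ newPath (maxEdges D) (towerCount (maxEdges D) e) e.2.2,
      X ∈ newPath (maxEdges D) (towerCount (maxEdges D) e') e'.2.2 → X ∈ (uniformize P D).1 := by
  intro X hX hX'
  have hde := hD.2.1 e he
  have hde' := hD.2.1 e' he'
  obtain ⟨p, q, l, hπ⟩ := exists_eq_cons_cons_of_mem hD he
  obtain ⟨p', q', l', hπ'⟩ := exists_eq_cons_cons_of_mem hD he'
  have hnd := hde.2.2.2.2.2.1; have hch := hde.2.2.2.2.2.2.1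
  have hnd' := hde'.2.2.2.2.2.1; have hch' := hde'.2.2.2.2.2.2.1
  rw [hπ] at hnd hch hX; rw [hπ'] at hnd' hch' hX'
  have hT : towerCount (maxEdges D) e ≤ 2 * maxEdges D := towerCount_le _ _
  have hT' : towerCount (maxEdges D) e' ≤ 2 * maxEdges D := towerCount_le _ _
  have hM : ((bigM (maxEdges D) : ℕ) : ℤ) ≠ 0 := by have := one_le_maxEdges D; unfold bigM; push_cast; omega
  rw [uniformize]; dsimp only
  -- a common point of the original paths that is a vertex image, scaled, is a scaled vertex image
  have img : ∀ x ∈ P, (bigM (maxEdges D) : ℤ) • x ∈ P.map (fun p => (bigM (maxEdges D) : ℤ) • p) := fun x hx =>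
    mem_map_smul.2 ⟨x, hx, rfl⟩
  -- two distinct common vertex images are impossible
  have two : ∀ {x y : GridPoint}, x ≠ y → x ∈ p :: q :: l → x ∈ p' :: q' :: l' → y ∈ p :: q :: l → y ∈ p' :: q' :: l' → False := by
    intro x y hxy hx hx' hy hy'
    have hxP : x ∈ P := hcf x (hπ ▸ hx) (hπ' ▸ hx')
    have hyP : y ∈ P := hcf y (hπ ▸ hy) (hπ' ▸ hy')
    exact hns (sameEnds_of_two_common hD.1 hde hde' hxy (hπ ▸ hx) (hπ' ▸ hx') (hπ ▸ hy) (hπ' ▸ hy') hxP hyP)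
  have hu : IsUnitVec (q - p) := (isGridEdge_iff_isUnitVec _ _).1 (List.isChain_cons_cons.1 hch).1
  have hu' : IsUnitVec (q' - p') := (isGridEdge_iff_isUnitVec _ _).1 (List.isChain_cons_cons.1 hch').1
  rcases (mem_newPath p q l).1 hX with hX | ⟨o, ho, -, hX⟩ <;> rcases (mem_newPath p' q' l').1 hX' with hX' | ⟨o', ho', -, hX'⟩
  · -- run / run (or last points)
    rcases (mem_scalePath p (q :: l)).1 hX with ⟨i, hi, s, hs, rfl⟩ | rfl
    · rcases (mem_scalePath p' (q' :: l')).1 hX' with ⟨j, hj, s', hs', h⟩ | h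
      · rcases runPt_eq_runPt (isUnitVec_step hch hi) (isUnitVec_step hch' hj) hs hs' h with
          ⟨rfl, -, hc⟩ | ⟨-, -, hc, hcu⟩ | ⟨-, -, hc, hcu, -⟩
        · rw [runPt_zero]
          refine img _ (hcf _ ?_ ?_)
          · rw [hπ]; exact List.getElem_mem _
          · rw [hπ', hc]; exact List.getElem_mem _
        · exfalso
          have hc1 : (p :: q :: l)[i + 1] = (p' :: q' :: l')[j + 1] := by
            have e1 : (p :: q :: l)[i + 1] = (p :: q :: l)[i]'(Nat.lt_of_succ_lt hi) +
              ((p :: q :: l)[i + 1] - (p :: q :: l)[i]'(Nat.lt_of_succ_lt hi)) := by abel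
            rw [e1, hcu, hc]; abel
          refine two (x := (p :: q :: l)[i]'(Nat.lt_of_succ_lt hi)) (y := (p :: q :: l)[i + 1]) (fun h => ?_)
            (List.getElem_mem _) (by rw [hc]; exact List.getElem_mem _) (List.getElem_mem _)
            (by rw [hc1]; exact List.getElem_mem _)
          have := (hnd.getElem_inj_iff).1 h; omega
        · exfalso
          have hc0 : (p' :: q' :: l')[j]'(Nat.lt_of_succ_lt hj) = (p :: q :: l)[i + 1] := by rw [hc]; abel
          have hc1 : (p' :: q' :: l')[j + 1] = (p :: q :: l)[i]'(Nat.lt_of_succ_lt hi) := by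
            have e2 : (p' :: q' :: l')[j + 1] = (p' :: q' :: l')[j]'(Nat.lt_of_succ_lt hj) +
              ((p' :: q' :: l')[j + 1] - (p' :: q' :: l')[j]'(Nat.lt_of_succ_lt hj)) := by abel
            rw [e2, hcu, hc]; abel
          refine two (x := (p :: q :: l)[i]'(Nat.lt_of_succ_lt hi)) (y := (p :: q :: l)[i + 1]) (fun h => ?_)
            (List.getElem_mem _) (by rw [← hc1]; exact List.getElem_mem _) (List.getElem_mem _)
            (by rw [← hc0]; exact List.getElem_mem _)
          have := (hnd.getElem_inj_iff).1 h; omega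
      · rw [h]; exact img _ (getLast_mem_P hde' hπ')
    · exact img _ (getLast_mem_P hde hπ)
  · -- run / tower
    exfalso
    obtain ⟨hlo', hhi'⟩ := towerOffsets_window hT' ho'
    obtain ⟨k, hk1, hk, h | h⟩ := mem_tower.1 hX' <;> rcases (mem_scalePath p (q :: l)).1 hX with ⟨i, hi, s, -, rfl⟩ | rfl
    · exact towerPt_ne_runPt hu' p' hlo' (by omega) hk1 hk (isUnitVec_step hch hi) _ s h.symm
    · exact towerPt_ne_smul hu' p' hlo' (by omega) hk1 hk _ h.symm
    · exact towerPt_ne_runPt hu' p' (by omega) hhi' hk1 hk (isUnitVec_step hch hi) _ s h.symm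
    · exact towerPt_ne_smul hu' p' (by omega) hhi' hk1 hk _ h.symm
  · -- tower / run
    exfalso
    obtain ⟨hlo, hhi⟩ := towerOffsets_window hT ho
    obtain ⟨k, hk1, hk, rfl | rfl⟩ := mem_tower.1 hX <;> rcases (mem_scalePath p' (q' :: l')).1 hX' with ⟨j, hj, s', -, h⟩ | h
    · exact towerPt_ne_runPt hu p hlo (by omega) hk1 hk (isUnitVec_step hch' hj) _ s' h
    · exact towerPt_ne_smul hu p hlo (by omega) hk1 hk _ h
    · exact towerPt_ne_runPt hu p (by omega) hhi hk1 hk (isUnitVec_step hch' hj) _ s' h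
    · exact towerPt_ne_smul hu p (by omega) hhi hk1 hk _ h
  · -- tower / tower: same direction and base, so the first unit edges coincide
    exfalso
    obtain ⟨hlo, hhi⟩ := towerOffsets_window hT ho
    obtain ⟨hlo', hhi'⟩ := towerOffsets_window hT' ho'
    have key : q - p = q' - p' ∧ p = p' := by
      obtain ⟨k, hk1, hk, rfl | rfl⟩ := mem_tower.1 hX <;> obtain ⟨k', hk1', hk', h | h⟩ := mem_tower.1 hX'
      · obtain ⟨h1, h2, -⟩ := towerPt_inj hu hu' p p' hlo (by omega) hk1 hk hlo' (by omega) hk1' hk' h; exact ⟨h1, h2⟩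
      · obtain ⟨h1, h2, -⟩ := towerPt_inj hu hu' p p' hlo (by omega) hk1 hk (by omega) hhi' hk1' hk' h; exact ⟨h1, h2⟩
      · obtain ⟨h1, h2, -⟩ := towerPt_inj hu hu' p p' (by omega) hhi hk1 hk hlo' (by omega) hk1' hk' h; exact ⟨h1, h2⟩
      · obtain ⟨h1, h2, -⟩ := towerPt_inj hu hu' p p' (by omega) hhi hk1 hk (by omega) hhi' hk1' hk' h; exact ⟨h1, h2⟩
    obtain ⟨hqp, rfl⟩ := key
    have hq : q = q' := by
      have : q = p + (q - p) := by abel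
      rw [this, hqp]; abel
    subst hq
    refine two (x := p) (y := q) (fun h => ?_) (by simp) (by simp) (by simp) (by simp)
    rw [h] at hnd
    simp at hnd

/-- Degrees are unchanged by re-drawing. [folklore] -/
theorem drawnDegree_uniformize (v : ℕ) : drawnDegree (uniformize P D).2 v = drawnDegree D v := by
  simp [drawnDegree, uniformize, List.countP_map, Function.comp_def]

/-- **The uniformised drawing is a congestion-free grid drawing** of the same graph.
[cite: LiskiewiczOgiharaToda2003, §4 (proof of Theorem 7, E₂)] -/
theorem isGridDrawing_uniformize (hD : IsGridDrawing P D) : IsGridDrawing (uniformize P D).1 (uniformize P D).2 := by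
  have hM : ((bigM (maxEdges D) : ℕ) : ℤ) ≠ 0 := by have := one_le_maxEdges D; unfold bigM; push_cast; omega
  refine ⟨?_, ?_, ?_, ?_, ?_⟩
  · exact hD.1.map (smul_right_injective _ hM)
  · intro e₂ he₂
    obtain ⟨e, he, rfl⟩ := List.mem_map.1 he₂
    exact isDrawnEdgeOf_newPath hD he
  · rw [uniformize, List.pairwise_map]
    exact hD.2.2.1.imp fun h => h
  · rw [uniformize, List.pairwise_map]
    have h := (hD.2.2.1.and hD.2.2.2.1)
    rw [List.Pairwise.and_mem] at h
    exact h.imp fun ⟨he, he', hns, hcf⟩ => newPath_common hD he he' hns hcf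
  · intro v hv
    rw [drawnDegree_uniformize]
    exact hD.2.2.2.2 v (by simpa using hv)

/-- **The tower step, counting form.** For a congestion-free grid drawing with `N ≥ 2`
vertices and vertices `s, t`, the number of Hamiltonian `s`–`t` paths equals the version-(1)
count of the uniformised drawing's realised subgraph moved to the origin, at the scaled image of
`t` and length `24 Λ² (N - 1)`: `#HamPath(G′, s′, t′) = SAWCOUNT₁(E₂, τ, h)` as numbers (the
machine-free content of `R₁(x) = (E₂, τ, h)`; with `GridSAWUniformDrawingCount`'s identity for
uniform drawings). [cite: LiskiewiczOgiharaToda2003, Theorem 7 (proof: "the number of SAWs in E₂ having length h is exactly the number of Hamiltonian paths in G′")] -/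
theorem hamPathCount_eq_sawCountFixedLength_uniformize (hD : IsGridDrawing P D) (hN : 2 ≤ P.length) {s t : ℕ}
    (hs : s < P.length) (ht : t < P.length) :
    hamPathCount P.length D s t =
      sawCountFixedLength (translate (-(((uniformize P D).1)[s]'(by simpa using hs))) (drawnEdges (uniformize P D).2))
        (((uniformize P D).1)[t]'(by simpa using ht) - ((uniformize P D).1)[s]'(by simpa using hs))
        (24 * maxEdges D * maxEdges D * (P.length - 1)) := by
  have h := sawCountFixedLength_drawnEdges_eq_hamPathCount (isGridDrawing_uniformize hD) (length_uniformize hD)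
    (by simpa using hN) (s := s) (t := t) (by simpa using hs) (by simpa using ht)
  simp only [length_uniformize_fst] at h
  rw [h, hamPathCount_eq_of_map_ends_eq (map_ends_uniformize P D)]

/-- The instance of the tower step is a subgraph of the grid. [folklore] -/
theorem isGridSubgraph_uniformize (hD : IsGridDrawing P D) (v : GridPoint) :
    IsGridSubgraph (translate v (drawnEdges (uniformize P D).2)) :=
  isGridSubgraph_translate (isGridSubgraph_drawnEdges (isGridDrawing_uniformize hD)) v

end Drawing

/-! ### Sanity checks (the one-edge drawing) -/

/-- On the one-edge drawing `Λ = 1`: one unit edge. [folklore] -/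
theorem maxEdges_oneEdge : maxEdges oneEdgeDrawing.2 = 1 := by decide

/-- Non-vacuity of the tower step: on the one-edge drawing (`N = 2`, one Hamiltonian `0`–`1`
path) the uniformised instance — a straight path of `24` unit edges from the origin — has exactly
one SAW of length `24` to its far end. [folklore] -/
theorem sawCountFixedLength_uniformize_oneEdge :
    sawCountFixedLength
      (translate (-(((uniformize oneEdgeDrawing.1 oneEdgeDrawing.2).1)[0]'(by decide)))
        (drawnEdges (uniformize oneEdgeDrawing.1 oneEdgeDrawing.2).2))
      (((uniformize oneEdgeDrawing.1 oneEdgeDrawing.2).1)[1]'(by decide) -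
        ((uniformize oneEdgeDrawing.1 oneEdgeDrawing.2).1)[0]'(by decide))
      (24 * maxEdges oneEdgeDrawing.2 * maxEdges oneEdgeDrawing.2 * (2 - 1)) = 1 := by
  have h := hamPathCount_eq_sawCountFixedLength_uniformize (P := oneEdgeDrawing.1) (D := oneEdgeDrawing.2)
    isGridDrawing_oneEdge (by decide) (s := 0) (t := 1) (by decide) (by decide)
  have hlen : oneEdgeDrawing.1.length = 2 := rfl
  simp only [hlen, hamPathCount_oneEdge] at h
  exact h.symm

end Literature.Barriers.CriticalPhenomena.GridSAW
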